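import Summits.HubbardSuperconductivity.HubbardLadder.Bounds.ComplexSeamGauge
import Summits.HubbardSuperconductivity.HubbardLadder.Bounds.TwistInsensitivityHolder
import Literature.Probability.LatticeModels.PolymerPressureAnalytic
import HarnessLib

/-!
# The polymer gas of the complex-twisted `t–t'` torus: smallness on the strip `|Im θ| ≤ Lη` and
# analyticity of the Kotecký–Preiss logarithm in the twist
# (bounds.tex Theorem 12 (i) on the strip / step 2 of (iii) — LEAN FILING REQUEST #206.2, bounds g27)

HONEST FRAMING (cell pub-hubbard): ladder R1–R4 with certified numbers; no claim on H/H₀. This file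
is a BOUND FOR A MODEL CLASS (the seam-twisted `t–t'` Hubbard torus at high temperature, any sign
of `U`, any `μ`); no materials claim.

With `ρ_θ := siteActivityC (hubbardBonds (ttGraph L)) β U μ (ttFluxCouplingC L β t' θ)` the polymer
activities of the torus twisted by a COMPLEX seam angle `θ` (`ttActivityC`; `= ttActivity … θ` for
real `θ`):

* `ttActivityC_eq_of_card_lt` — winding dichotomy: `ρ_θ(A) = ρ_0(A)` whenever `|A| < L` (complex
  column gauge, `ComplexSeamGauge`). PROVED.
* `isSmallActivityA_ttActivityC` — one-site Kotecký–Preiss smallness with weight `a` and rate `δ`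
  on the closed strip `|Im θ| ≤ Lη`, under the Hölder-form hypothesis
  `16 s e^{2s} (e^{a+δ}+a)² ≤ a`, `s ≥ |β|(1+|t'|) e^{η}`: the spreading gauge makes every bond factor
  at most `e^{|Im θ|/L} ≤ e^{η}` (bounds.tex Lemma 12.3–12.4 with `t_δ ↦ t_δ e^{η}`). PROVED.
* `norm_polymerLogZ_ttActivityC_sub_le` — `‖log Ξ(ρ_θ) - log Ξ(ρ_0)‖ ≤ 2a L² e^{-δL}` on the closed
  strip (bounds.tex (12.2) for complex twists, seam variable). PROVED.
* `differentiableOn_polymerLogZ_ttActivityC` / `continuousOn_polymerLogZ_ttActivityC` — the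
  Kotecký–Preiss logarithm `θ ↦ log Ξ(ρ_θ)` is holomorphic on the open strip `|Im θ| < Lη` and
  continuous on the closed one (tree: `differentiableOn_polymerLogZ_param`,
  `continuousOn_polymerLogZ_param`, [KoteckyPreiss1986] p. 493). PROVED.

References: R. Kotecký, D. Preiss, Comm. Math. Phys. 103 (1986) 491 [KoteckyPreiss1986];
D. Ueltschi, J. Stat. Phys. 95 (1999) 693, §2.3 and Prop. 2.2 [Ueltschi1999]; bounds.tex §12.
-/

noncomputable section

namespace Summit.HubbardSuperconductivity.HubbardLadder.Bounds

open Matrix Finset Literature.MathematicalPhysics.QuantumLattice Literature.Probability.LatticeModels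
open scoped ComplexConjugate ComplexOrder

section Torus

open Literature.MathematicalPhysics.QuantumFieldTheory

variable {L : ℕ} [NeZero L]

/-- **The polymer activities of the complex-twisted `t–t'` torus**:
`ρ_θ = siteActivityC (hubbardBonds (ttGraph L)) β U μ (ttFluxCouplingC L β t' θ)`, `θ ∈ ℂ`.
[programme definition: bounds.tex §12, proof of Thm 12 (iii)] -/
def ttActivityC (L : ℕ) [NeZero L] (β t' U μ : ℝ) (θ : ℂ) : Finset (FermionTorus 2 L) → ℂ :=
  siteActivityC (hubbardBonds (ttGraph L)) (β : ℂ) (U : ℂ) (μ : ℂ) (ttFluxCouplingC L β t' θ)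

/-- For a real angle the complex-twisted activities are #181.6's `ttActivity`. [this file] -/
theorem ttActivityC_ofReal (hL : 3 ≤ L) (β t' U μ θ : ℝ) :
    ttActivityC L β t' U μ (θ : ℂ) = ttActivity L β t' U μ θ := by
  rw [ttActivityC, ttFluxCouplingC_ofReal hL, ttActivity]

/-- At `θ = 0` the complex-twisted activities are the untwisted ones. [this file] -/
theorem ttActivityC_zero (β t' U μ : ℝ) : ttActivityC L β t' U μ 0 = ttActivity L β t' U μ 0 := by
  rw [ttActivityC, ttFluxCouplingC_zero, ttActivity]

/-- **Winding dichotomy, complex twists**: polymers with fewer than `L` sites have the same activity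
at every complex twist as at twist `0`. [this file, from `ComplexSeamGauge`] -/
theorem ttActivityC_eq_of_card_lt (hL : 3 ≤ L) (β t' U μ : ℝ) (θ : ℂ) {A : Finset (FermionTorus 2 L)}
    (hA : A.card < L) : ttActivityC L β t' U μ θ A = ttActivity L β t' U μ 0 A := by
  rcases siteActivityC_twistC_dichotomy hL β t' U μ θ (hubbardBonds (ttGraph L)) A with h | h
  · exact h
  · exact absurd hA (not_lt.2 h)

/-- The complex-twisted activities are those of the spread coupling (spreading gauge). [this file] -/
theorem ttActivityC_eq_spread (β t' U μ : ℝ) (θ : ℂ) (A : Finset (FermionTorus 2 L)) :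
    ttActivityC L β t' U μ θ A =
      siteActivityC (hubbardBonds (ttGraph L)) (β : ℂ) (U : ℂ) (μ : ℂ) (ttSpreadCouplingC L β t' θ) A :=
  (siteActivityC_ttSpreadCouplingC_eq β t' (β : ℂ) (U : ℂ) (μ : ℂ) θ _ A).symm

/-! ### Smallness on the strip -/

/-- **One-site Kotecký–Preiss smallness of the complex-twisted activities, Hölder form**: if
`|Im θ| ≤ Lη`, `|β|(1+|t'|) e^{η} ≤ s`, `a, δ ≥ 0` and `16 s e^{2s} (e^{a+δ}+a)² ≤ a`, then
`Σ_{A ∋ x} |ρ_θ(A)| e^{(a+δ)|A|} ≤ a` for every site `x` and all `U, μ`. [programme: bounds.tex §12,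
Lemmas 12.3–12.4 and 12.6 on the strip (`t_δ ↦ t_δ e^{η}`)] -/
theorem sum_norm_ttActivityC_mul_exp_le_exp (hL : 3 ≤ L) (β t' U μ : ℝ) (θ : ℂ) {η s a δ : ℝ}
    (hη : |θ.im| ≤ L * η) (hs : |β| * (1 + |t'|) * Real.exp η ≤ s) (ha : 0 ≤ a) (hδ : 0 ≤ δ)
    (hsmall : 16 * s * Real.exp (2 * s) * (Real.exp (a + δ) + a) ^ 2 ≤ a)
    (x : FermionTorus 2 L) (𝒜 : Finset (Finset (FermionTorus 2 L))) (h𝒜 : ∀ A ∈ 𝒜, x ∈ A) :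
    ∑ A ∈ 𝒜, ‖ttActivityC L β t' U μ θ A‖ * Real.exp ((a + δ) * A.card) ≤ a := by
  have hL0 : (0 : ℝ) < L := by exact_mod_cast (show 0 < L by omega)
  have heL : Real.exp (|θ.im| / L) ≤ Real.exp η :=
    Real.exp_le_exp.2 ((div_le_iff₀ hL0).2 (by linarith [mul_comm (L : ℝ) η]))
  have hX : 0 ≤ |β| * (2 + 2 * |t'|) := by positivity
  have hY : 0 ≤ 16 * (|β| * (1 + |t'|)) := by positivity
  have h2s : ∀ b : Bond (FermionTorus 2 L), ‖ttSpreadCouplingC L β t' θ b‖ ≤ 2 * s := fun b =>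
    (norm_ttSpreadCouplingC_le' hL β t' θ b).trans
      (by nlinarith [mul_le_mul_of_nonneg_right heL hX, Real.exp_pos η])
  have haδ : (0 : ℝ) ≤ a + δ := add_nonneg ha hδ
  have hF : Real.exp (a + δ) + 16 * s * Real.exp (2 * s) * (Real.exp (a + δ) + a) ^ 2 ≤
      Real.exp (a + δ) + a := by linarith
  have key : ∑ A ∈ 𝒜, ‖ttActivityC L β t' U μ θ A‖ * Real.exp ((a + δ) * A.card) ≤
      (Real.exp (a + δ) + a) - Real.exp (a + δ) := by
    simp only [ttActivityC_eq_spread, siteActivityC_eq_couplingActivity]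
    refine sum_norm_couplingActivity_mul_exp_le_catalan_exp β U μ
      (δ := fun b => ‖ttSpreadCouplingC L β t' θ b‖) (fun _ _ => le_rfl) haδ (fun v => ?_) hF x 𝒜 h𝒜
    -- the weighted degree `Σ_{b ∋ v} (e^{|c_b|} - 1) ≤ Σ_{b ∋ v} |c_b| e^{2s} ≤ 16 s e^{2s}`
    have hem : ∀ x : ℝ, Real.exp x - 1 ≤ x * Real.exp x := fun x => by
      have h2 : Real.exp x * (-x + 1) ≤ Real.exp x * Real.exp (-x) :=
        mul_le_mul_of_nonneg_left (Real.add_one_le_exp (-x)) (Real.exp_pos x).le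
      rw [← Real.exp_add, add_neg_cancel, Real.exp_zero] at h2
      linarith
    have hb1 : ∀ b : Bond (FermionTorus 2 L), Real.exp ‖ttSpreadCouplingC L β t' θ b‖ - 1 ≤
        ‖ttSpreadCouplingC L β t' θ b‖ * Real.exp (2 * s) := fun b =>
      (hem _).trans (mul_le_mul_of_nonneg_left (Real.exp_le_exp.2 (h2s b)) (norm_nonneg _))
    refine (Finset.sum_le_sum fun b _ => hb1 b).trans ?_
    rw [← Finset.sum_mul]
    refine mul_le_mul_of_nonneg_right ?_ (Real.exp_nonneg _)
    refine (sum_norm_ttSpreadCouplingC_le hL β t' θ v _ fun b hb =>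
      (@mem_verts_iff _ (_) _ _).1 ((@Finset.mem_filter _ _ (_) _ _).1 hb).2).trans ?_
    nlinarith [mul_le_mul_of_nonneg_right heL hY, Real.exp_pos η]
  linarith

/-- **Smallness with weight `a` on the closed strip** (Hölder form): under `|Im θ| ≤ Lη`,
`|β|(1+|t'|) e^{η} ≤ s`, `16 s e^{2s} (e^{a+δ}+a)² ≤ a`, `a, δ > 0`, the complex-twisted activities
satisfy the tree's `IsSmallActivityA · a δ`. [this file] -/
theorem isSmallActivityA_ttActivityC (hL : 3 ≤ L) (β t' U μ : ℝ) (θ : ℂ) {η s a δ : ℝ}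
    (hη : |θ.im| ≤ L * η) (hs : |β| * (1 + |t'|) * Real.exp η ≤ s) (ha : 0 < a) (hδ : 0 < δ)
    (hsmall : 16 * s * Real.exp (2 * s) * (Real.exp (a + δ) + a) ^ 2 ≤ a) :
    IsSmallActivityA (ttActivityC L β t' U μ θ) a δ where
  rho_empty := siteActivityC_empty _ _ _ _ _
  a_pos := ha
  delta_pos := hδ
  sum_le x 𝒜 h𝒜 := sum_norm_ttActivityC_mul_exp_le_exp hL β t' U μ θ hη hs ha.le hδ.le hsmall x 𝒜 h𝒜

/-- The untwisted activities are small under the strip hypothesis (the case `θ = 0`). [this file] -/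
theorem isSmallActivityA_ttActivity_zero_of_strip (hL : 3 ≤ L) (β t' U μ : ℝ) {η s a δ : ℝ}
    (hη : 0 ≤ η) (hs : |β| * (1 + |t'|) * Real.exp η ≤ s) (ha : 0 < a) (hδ : 0 < δ)
    (hsmall : 16 * s * Real.exp (2 * s) * (Real.exp (a + δ) + a) ^ 2 ≤ a) :
    IsSmallActivityA (ttActivity L β t' U μ 0) a δ := by
  have h := isSmallActivityA_ttActivityC hL β t' U μ 0 (η := η)
    (by rw [Complex.zero_im, abs_zero]; positivity) hs ha hδ hsmall
  rwa [ttActivityC_zero] at h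

/-- **The tail estimate on the closed strip**: for `|Im θ| ≤ Lη` (and the smallness hypothesis),
`‖log Ξ(ρ_θ) - log Ξ(ρ_0)‖ ≤ 2a L² e^{-δL}` (Kotecký–Preiss logarithms). [programme: bounds.tex §12,
(12.2) for complex twists] -/
theorem norm_polymerLogZ_ttActivityC_sub_le (hL : 3 ≤ L) (β t' U μ : ℝ) (θ : ℂ) {η s a δ : ℝ}
    (hη : |θ.im| ≤ L * η) (hs : |β| * (1 + |t'|) * Real.exp η ≤ s) (ha : 0 < a) (hδ : 0 < δ)
    (hsmall : 16 * s * Real.exp (2 * s) * (Real.exp (a + δ) + a) ^ 2 ≤ a) :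
    ‖polymerLogZ polyInc (ttActivityC L β t' U μ θ) (Finset.univ : Finset (FermionTorus 2 L)).powerset -
        polymerLogZ polyInc (ttActivity L β t' U μ 0) (Finset.univ : Finset (FermionTorus 2 L)).powerset‖ ≤
      2 * a * (L : ℝ) ^ 2 * Real.exp (-(δ * L)) := by
  have hL0 : (0 : ℝ) < L := by exact_mod_cast (show 0 < L by omega)
  have hη0 : 0 ≤ η := by
    have : 0 ≤ (L : ℝ) * η := (abs_nonneg _).trans hη
    exact nonneg_of_mul_nonneg_right this hL0
  have h := (isSmallActivityA_ttActivityC hL β t' U μ θ hη hs ha hδ hsmall).norm_polymerLogZ_sub_le_of_eq_of_card_lt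
    (isSmallActivityA_ttActivity_zero_of_strip hL β t' U μ hη0 hs ha hδ hsmall)
    (Finset.univ : Finset (FermionTorus 2 L)).powerset hL0
    (fun A _ hA => ttActivityC_eq_of_card_lt hL β t' U μ θ (by exact_mod_cast hA))
  have hcard : (Fintype.card (FermionTorus 2 L) : ℝ) = (L : ℝ) ^ 2 := by
    simp [FermionTorus, Fintype.card_lex]
  rw [hcard] at h
  exact h

/-! ### Analyticity in the twist -/

omit [NeZero L] in
/-- The complex seam phase is an entire function of the angle. [this file] -/
theorem differentiable_seamPhaseC (u v : FermionTorus 2 L) :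
    Differentiable ℂ (fun θ : ℂ => seamPhaseC L θ u v) := by
  by_cases h1 : col u = 0 ∧ col v = L - 1
  · simp only [seamPhaseC, if_pos h1]
    exact (differentiable_id.mul_const _).cexp
  · by_cases h2 : col u = L - 1 ∧ col v = 0
    · simp only [seamPhaseC, if_neg h1, if_pos h2]
      exact (differentiable_id.mul_const _).neg.cexp
    · simp only [seamPhaseC, if_neg h1, if_neg h2]
      exact differentiable_const _

/-- Every complex-twisted coupling constant is an entire function of the angle. [this file] -/
theorem differentiable_ttFluxCouplingC_apply (β t' : ℝ) (b : Bond (FermionTorus 2 L)) :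
    Differentiable ℂ (fun θ : ℂ => ttFluxCouplingC L β t' θ b) :=
  (differentiable_seamPhaseC b.1 b.2.1).mul_const _

/-- **Every polymer activity is an entire function of the complex twist** (finite sums of ratios of
traces of matrix exponentials, `differentiable_gibbsRatio`). [this file; Ueltschi1999 §2.3] -/
theorem differentiable_ttActivityC_apply (β t' U μ : ℝ) (A : Finset (FermionTorus 2 L)) :
    Differentiable ℂ (fun θ : ℂ => ttActivityC L β t' U μ θ A) := by
  have hc : ∀ K' : Finset (Bond (FermionTorus 2 L)),
      Differentiable ℂ (fun θ : ℂ => restrictCoupling (ttFluxCouplingC L β t' θ) K') := fun K' =>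
    differentiable_pi.2 fun b => by
      by_cases hb : b ∈ K'
      · simp only [restrictCoupling, if_pos hb]
        exact differentiable_ttFluxCouplingC_apply β t' b
      · simp only [restrictCoupling, if_neg hb]
        exact differentiable_const _
  simp only [ttActivityC, siteActivityC_apply, bondWeightC]
  refine Differentiable.fun_sum fun X _ => Differentiable.fun_sum fun K' _ => ?_
  refine Differentiable.const_mul ?_ _
  exact (differentiable_gibbsRatio (β : ℂ) (U : ℂ) (μ : ℂ)).comp (hc K')

/-- The open strip `|Im θ| < Lη` of complex seam angles. [programme definition: bounds.tex §12,
Thm 12 (i) (`|Im A| < η`, `A = θ/L`)] -/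
def twistStrip (L : ℕ) (η : ℝ) : Set ℂ := {θ : ℂ | |θ.im| < L * η}

/-- The closed strip `|Im θ| ≤ Lη`. [programme definition: bounds.tex §12, Thm 12 (i)] -/
def twistStripClosed (L : ℕ) (η : ℝ) : Set ℂ := {θ : ℂ | |θ.im| ≤ L * η}

omit [NeZero L] in
/-- Membership in the open strip. [this file] -/
theorem mem_twistStrip {η : ℝ} {θ : ℂ} : θ ∈ twistStrip L η ↔ |θ.im| < L * η := Iff.rfl

omit [NeZero L] in
/-- Membership in the closed strip. [this file] -/
theorem mem_twistStripClosed {η : ℝ} {θ : ℂ} : θ ∈ twistStripClosed L η ↔ |θ.im| ≤ L * η := Iff.rfl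

omit [NeZero L] in
/-- The open strip lies in the closed one. [this file] -/
theorem twistStrip_subset_closed (η : ℝ) : twistStrip L η ⊆ twistStripClosed L η :=
  fun _ hθ => mem_twistStripClosed.2 (mem_twistStrip.1 hθ).le

omit [NeZero L] in
/-- The open strip is open. [this file] -/
theorem isOpen_twistStrip (η : ℝ) : IsOpen (twistStrip L η) :=
  isOpen_lt (continuous_abs.comp Complex.continuous_im) continuous_const

/-- **Zero-freeness along the rays on the closed strip**: `Ξ(u ρ_θ) ≠ 0` for `u ∈ [0,1]`,
`|Im θ| ≤ Lη`. [this file; KoteckyPreiss1986 Theorem p. 492] -/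
theorem polymerPartitionFunction_ray_ttActivityC_ne_zero (hL : 3 ≤ L) (β t' U μ : ℝ) {η s a δ : ℝ}
    (hs : |β| * (1 + |t'|) * Real.exp η ≤ s) (ha : 0 < a) (hδ : 0 < δ)
    (hsmall : 16 * s * Real.exp (2 * s) * (Real.exp (a + δ) + a) ^ 2 ≤ a)
    {θ : ℂ} (hθ : θ ∈ twistStripClosed L η) {u : ℝ} (hu : u ∈ Set.Icc (0 : ℝ) 1) :
    polymerPartitionFunction polyInc (fun A => (u : ℂ) * ttActivityC L β t' U μ θ A)
      (Finset.univ : Finset (FermionTorus 2 L)).powerset ≠ 0 := by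
  have hKP := (isSmallActivityA_ttActivityC hL β t' U μ θ (mem_twistStripClosed.1 hθ) hs ha hδ
    hsmall).isKPVolume
    (Finset.univ : Finset (FermionTorus 2 L)).powerset
  have hKPu : IsKPVolume polyInc (fun A => (u : ℂ) * ttActivityC L β t' U μ θ A)
      (fun A : Finset (FermionTorus 2 L) => a * (A.card : ℝ))
      (Finset.univ : Finset (FermionTorus 2 L)).powerset := fun γ hγ => by
    refine le_trans (Finset.sum_le_sum fun γ' _ => ?_) (hKP γ hγ)
    unfold kpTerm
    refine mul_le_mul_of_nonneg_right ?_ (Real.exp_nonneg _)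
    rw [norm_mul, Complex.norm_real, Real.norm_eq_abs, abs_of_nonneg hu.1]
    exact mul_le_of_le_one_left (norm_nonneg _) hu.2
  exact polymerPartitionFunction_ne_zero_of_kp hKPu Finset.Subset.rfl

/-- **Holomorphy of the Kotecký–Preiss logarithm in the complex twist** on the open strip
`|Im θ| < Lη` (bounds.tex Thm 12 (i): "log Z_L(β,·) has an analytic branch on `{|Im A| < η}`").
[this file; KoteckyPreiss1986 p. 493, Ueltschi1999 Prop. 2.2] -/
theorem differentiableOn_polymerLogZ_ttActivityC (hL : 3 ≤ L) (β t' U μ : ℝ) {η s a δ : ℝ}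
    (hs : |β| * (1 + |t'|) * Real.exp η ≤ s) (ha : 0 < a) (hδ : 0 < δ)
    (hsmall : 16 * s * Real.exp (2 * s) * (Real.exp (a + δ) + a) ^ 2 ≤ a) :
    DifferentiableOn ℂ (fun θ : ℂ => polymerLogZ polyInc (ttActivityC L β t' U μ θ)
      (Finset.univ : Finset (FermionTorus 2 L)).powerset) (twistStrip L η) :=
  differentiableOn_polymerLogZ_param (Finset.univ : Finset (FermionTorus 2 L)).powerset
    (isOpen_twistStrip η) (fun A _ => (differentiable_ttActivityC_apply β t' U μ A).differentiableOn)
    fun _ hz _ hu => polymerPartitionFunction_ray_ttActivityC_ne_zero hL β t' U μ hs ha hδ hsmall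
      (twistStrip_subset_closed η hz) hu

/-- **Continuity of the Kotecký–Preiss logarithm in the complex twist** on the closed strip
`|Im θ| ≤ Lη` ("continuous up to the boundary"). [this file; KoteckyPreiss1986 §2] -/
theorem continuousOn_polymerLogZ_ttActivityC (hL : 3 ≤ L) (β t' U μ : ℝ) {η s a δ : ℝ}
    (hs : |β| * (1 + |t'|) * Real.exp η ≤ s) (ha : 0 < a) (hδ : 0 < δ)
    (hsmall : 16 * s * Real.exp (2 * s) * (Real.exp (a + δ) + a) ^ 2 ≤ a) :
    ContinuousOn (fun θ : ℂ => polymerLogZ polyInc (ttActivityC L β t' U μ θ)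
      (Finset.univ : Finset (FermionTorus 2 L)).powerset) (twistStripClosed L η) :=
  continuousOn_polymerLogZ_param (Finset.univ : Finset (FermionTorus 2 L)).powerset
    (fun A _ => (differentiable_ttActivityC_apply β t' U μ A).continuous.continuousOn)
    fun _ hz _ hu => polymerPartitionFunction_ray_ttActivityC_ne_zero hL β t' U μ hs ha hδ hsmall hz hu

end Torus

end Summit.HubbardSuperconductivity.HubbardLadder.Bounds

end
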